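import Literature.NumberTheory.EllipticCurves.MinusTwistHeightDuplicationProofs
import HarnessLib

/-!
# The canonical `2`-adic height datum on the minus part of `V^{(d)}`, `d ∈ {−1, 2, −2}`: existence and
# uniqueness of `IsCanonicalSqMinusTwist`, boundary included (proofs only)

Topic `Literature/NumberTheory/EllipticCurves` (trunk T-NT-EC). Pure proof file (no definition, no named
fact); the capstone of the chain `PadicSigmaSqTwistTransportProofs` → `QuadraticTwistIntegralModelSigmaSq` →
`PadicSigmaSqMinusTwistPinning` / `…Uniqueness` → `SigmaSqInvXDuplication` → `TwistDuplicationDenominator` →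
`MinusTwistHeightDuplication`. Width seat `bsd-line-cf2-p1-w5` (g20) of the cell `bsd-print-cf2`, in support
of stmt-BirchSwinnertonDyer-20368 (road (C) `disegni-pair-two`; the re-cut's `stub_pin_minusTwist_two` =
ty2's residue (R1) «pinning / non-vacuity of `IsCanonicalSqMinusTwist` on the `j = −3375` twists,
`d ∈ {−1, ±2}`»). BSD is not proved by any of this.

* §1 `hasNonsingularReductionAt_twistModel_of_minusTwist_odd` — the odd-prime dictionary without any
  `2`-adic size hypothesis;
* §2 `norm_two_Φ₂_ΨSq₂` — `‖Φ₂(x′)‖₂ = ‖x′‖₂⁴`, `‖ψ₂²(x′)‖₂ = ‖x′‖₂³/4` on the disc `‖x′‖₂ > 4` (so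
  `‖x′(2P)‖₂ = 4‖x′‖₂`: doubling moves a boundary point OFF the boundary);
* §3 `isCanonicalSqMinusTwist_of_eq_off_boundary` (**the boundary `ord₂ x′ = −3` of `d = ±2`** via
  `4⟨P,P⟩ = ⟨2P,2P⟩ = h(2P) = 4h(P)`, `canonicalPAdicHeightSqMinusTwist_two_smul`),
  `exists_isCanonicalSqMinusTwist`, `existsUnique_isCanonicalSqMinusTwist` — **`∃! D : PAdicHeightData
  (V.quadraticTwist d) 2, D.IsCanonicalSqMinusTwist` for `V` elliptic `ℤ`-integral with a sigma-squared
  pair at `2` and `d ∈ {−1, 2, −2}`**;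
* §4 `cm7Twist_existsUnique_isCanonicalSqMinusTwist` — **binder-free on `W_k = 49a1^{(4k+1)}`,
  `d ∈ {−1, 2, −2}`**.

## Sources

* B. Mazur, W. Stein, J. Tate, Doc. Math. Extra Vol. Coates (2006), §1 eq. (1.1), §2.7. [MazurSteinTate2006]
* J. H. Silverman, Math. Ann. 332 (2005), §5 Thm. 11 (18), Rem. 2. [Silverman2005DivPoly]
* B. Perrin-Riou, Mém. SMF 17 (1984), Ch. III §1.2 Lemme 2. [Perrinriou1984]
* J. H. Silverman, *The Arithmetic of Elliptic Curves*, 2nd ed. (2009), III.1, VII.2, Exercise 3.7.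
  [SilvermanAEC2009]
-/

noncomputable section

open scoped Classical
open PowerSeries Literature.NumberTheory.EllipticCurves

namespace WeierstrassCurve

/-! ### §1 Odd-prime non-singularity on the integral twist model, without a `2`-adic hypothesis -/

section Locus

variable (V : WeierstrassCurve ℚ) (d : ℤ) (W : WeierstrassCurve ℚ)

/-- `v_ℓ(2) = 0` and `v_ℓ(d) = 0` for an odd prime `ℓ` and `d ∈ {−1, 2, −2}`. [folklore] -/
private theorem padicValRat_two_d_eq_zero'' {ℓ : ℕ} [Fact ℓ.Prime] (hℓ2 : ℓ ≠ 2) {d : ℤ}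
    (hd : d = -1 ∨ d = 2 ∨ d = -2) : padicValRat ℓ (2 : ℚ) = 0 ∧ padicValRat ℓ (d : ℚ) = 0 := by
  have h2 : padicValRat ℓ (2 : ℚ) = 0 := by
    have : padicValNat ℓ 2 = 0 := padicValNat.eq_zero_of_not_dvd fun h =>
      hℓ2 ((Nat.prime_dvd_prime_iff_eq (Fact.out : ℓ.Prime) Nat.prime_two).mp h)
    rw [show (2 : ℚ) = ((2 : ℕ) : ℚ) by norm_num, padicValRat.of_nat, this, Nat.cast_zero]
  refine ⟨h2, ?_⟩
  rcases hd with rfl | rfl | rfl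
  · rw [Int.cast_neg, Int.cast_one, padicValRat.neg, padicValRat.one]
  · rw [Int.cast_ofNat]; exact h2
  · push_cast; rw [padicValRat.neg]; exact h2

/-- **The receptacle's odd-prime conditions give non-singular reduction on the integral twist model at
every ODD prime** — the part of `hasNonsingularReductionAt_twistModel_of_minusTwist` that needs no `2`-adic
size hypothesis (so it also covers the boundary points of `d = ±2`). [Mazur–Stein–Tate 2006, §1; Silverman
AEC VII.2, III.1] [cite: MazurSteinTate2006, §1] -/
theorem hasNonsingularReductionAt_twistModel_of_minusTwist_odd (hd : d = -1 ∨ d = 2 ∨ d = -2)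
    (hW : (⟨Units.mk0 (2 : ℚ) two_ne_zero, 0, 0, 0⟩ : VariableChange ℚ) • W = V.quadraticTwist (d : ℚ))
    {X₁ Y₁ : ℚ} (h₁ : W.toAffine.Nonsingular X₁ Y₁)
    (hmin : ∀ ℓ : ℕ, ℓ.Prime → ℓ ≠ 2 → V.HasNonsingularMinusReductionAt (d : ℚ) ℓ (X₁ / 4 / (d : ℚ))) :
    ∀ ℓ : ℕ, ℓ.Prime → ℓ ≠ 2 → W.HasNonsingularReductionAt ℓ X₁ Y₁ := by
  obtain ⟨ha1, ha2, ha3, ha4, ha6⟩ := V.coeffs_of_scaleTwo_smul_eq d W hW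
  have hd0 : (d : ℚ) ≠ 0 := by rcases hd with rfl | rfl | rfl <;> norm_num
  intro ℓ hℓ hℓ2
  haveI : Fact ℓ.Prime := ⟨hℓ⟩
  obtain ⟨hv2, hvd⟩ := padicValRat_two_d_eq_zero'' hℓ2 hd
  set x' : ℚ := X₁ / 4 / (d : ℚ) with hx'
  have hX₁ : X₁ = 4 * (d : ℚ) * x' := by rw [hx']; field_simp
  -- the dictionary between `W` at `(X₁, Y₁)` and the completed cubic of `V` at `x′`
  have hΦx : W.toAffine.polynomialX.evalEval X₁ Y₁ =
      -(16 * (d : ℚ) ^ 2) * (3 * x' ^ 2 + V.b₂ / 2 * x' + V.b₄ / 2) := by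
    rw [Affine.evalEval_polynomialX, ha1, ha2, ha4, hX₁]; ring
  have hΦy : W.toAffine.polynomialY.evalEval X₁ Y₁ = 2 * Y₁ := by
    rw [Affine.evalEval_polynomialY, ha1, ha3]; ring
  have heq : Y₁ ^ 2 = 64 * (d : ℚ) ^ 3 * (x' ^ 3 + V.b₂ / 4 * x' ^ 2 + V.b₄ / 2 * x' + V.b₆ / 4) := by
    have := h₁.1
    rw [Affine.equation_iff, ha1, ha2, ha3, ha4, ha6, hX₁] at this
    linear_combination this
  have h4 : padicValRat ℓ (4 : ℚ) = 0 := by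
    rw [show (4 : ℚ) = 2 ^ 2 by norm_num, padicValRat.pow, hv2, mul_zero]
  have h16 : padicValRat ℓ (-(16 * (d : ℚ) ^ 2)) = 0 := by
    rw [padicValRat.neg, padicValRat.mul (by norm_num) (pow_ne_zero 2 hd0),
      show (16 : ℚ) = 2 ^ 4 by norm_num, padicValRat.pow, padicValRat.pow, hv2, hvd]; ring
  have h64 : padicValRat ℓ (64 * (d : ℚ) ^ 3) = 0 := by
    rw [padicValRat.mul (by norm_num) (pow_ne_zero 3 hd0), show (64 : ℚ) = 2 ^ 6 by norm_num,
      padicValRat.pow, padicValRat.pow, hv2, hvd]; ring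
  have hcase := hmin ℓ hℓ hℓ2
  simp only [HasNonsingularMinusReductionAt] at hcase
  rcases hcase with hlt | ⟨hf'0, hf'v⟩ | ⟨-, hf0, hfv⟩
  · -- `x′` has negative valuation: `P′` reduces to `O`, and so does `(X₁, Y₁)`
    refine Or.inl ?_
    have hx0 : x' ≠ 0 := by rintro h; rw [h, padicValRat.zero] at hlt; exact lt_irrefl _ hlt
    rw [hX₁, padicValRat.mul (mul_ne_zero (by norm_num) hd0) hx0, padicValRat.mul (by norm_num) hd0,
      h4, hvd]
    simpa using hlt
  · -- `f′(x′)` is an `ℓ`-unit: `Φ_x` is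
    refine Or.inr (Or.inl ⟨?_, ?_⟩)
    · rw [hΦx]; exact mul_ne_zero (neg_ne_zero.mpr (mul_ne_zero (by norm_num) (pow_ne_zero 2 hd0))) hf'0
    · rw [hΦx, padicValRat.mul (neg_ne_zero.mpr (mul_ne_zero (by norm_num) (pow_ne_zero 2 hd0))) hf'0,
        h16, hf'v, add_zero]
  · -- `f(x′)` is an `ℓ`-unit: `Y₁` is, hence `Φ_y = 2Y₁` is
    have hY0 : Y₁ ≠ 0 := by
      rintro rfl
      rw [zero_pow two_ne_zero] at heq
      exact mul_ne_zero (mul_ne_zero (by norm_num) (pow_ne_zero 3 hd0)) hf0 heq.symm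
    have hvY : padicValRat ℓ Y₁ = 0 := by
      have := congrArg (padicValRat ℓ) heq
      rw [padicValRat.pow, padicValRat.mul (mul_ne_zero (by norm_num) (pow_ne_zero 3 hd0)) hf0, h64,
        hfv] at this
      simpa using this
    refine Or.inr (Or.inr ⟨?_, ?_⟩)
    · rw [hΦy]; exact mul_ne_zero two_ne_zero hY0
    · rw [hΦy, padicValRat.mul two_ne_zero hY0, hv2, hvY, add_zero]

end Locus

/-! ### §2 `2`-adic sizes: `‖Φ₂(x′)‖₂ = ‖x′‖₂⁴`, `‖ψ₂²(x′)‖₂ = ‖x′‖₂³/4` for `‖x′‖₂ > 4` -/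

section TwoAdic

variable (V : WeierstrassCurve ℚ) [hV : V.IsIntegral ℤ]

/-- **For `‖x′‖₂ > 4`: `‖Φ₂(x′)‖₂ = ‖x′‖₂⁴` and `‖ψ₂²(x′)‖₂ = ‖x′‖₂³/4`** (`ℤ`-integral equation): on the
receptacle's disc the leading terms dominate also at `2`, where `‖4‖₂ = 1/4` costs the two extra powers
in the disc condition. Hence `‖x′(2P)‖₂ = ‖Φ₂/ψ₂²‖₂ = 4‖x′‖₂`. [Silverman AEC VII.2, Exercise 3.7;
Stein–Wuthrich 2013, §4.1] [cite: SilvermanAEC2009, Exercise 3.7] -/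
theorem norm_two_Φ₂_ΨSq₂ {x' : ℚ} (hx : 4 < ‖(x' : ℚ_[2])‖) :
    ‖((x' ^ 4 - V.b₄ * x' ^ 2 - 2 * V.b₆ * x' - V.b₈ : ℚ) : ℚ_[2])‖ = ‖(x' : ℚ_[2])‖ ^ 4 ∧
      ‖((4 * x' ^ 3 + V.b₂ * x' ^ 2 + 2 * V.b₄ * x' + V.b₆ : ℚ) : ℚ_[2])‖ = 4⁻¹ * ‖(x' : ℚ_[2])‖ ^ 3 := by
  obtain ⟨V₀, hV₀⟩ := hV.integral
  have hb : ∀ q : ℚ, (∃ z : ℤ, q = z) → ‖(q : ℚ_[2])‖ ≤ 1 := by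
    rintro q ⟨z, rfl⟩; rw [Rat.cast_intCast]; exact Padic.norm_int_le_one z
  have h₂ : ‖(V.b₂ : ℚ_[2])‖ ≤ 1 := hb _ ⟨V₀.b₂, by rw [hV₀]; simp [baseChange]⟩
  have h₄ : ‖(V.b₄ : ℚ_[2])‖ ≤ 1 := hb _ ⟨V₀.b₄, by rw [hV₀]; simp [baseChange]⟩
  have h₆ : ‖(V.b₆ : ℚ_[2])‖ ≤ 1 := hb _ ⟨V₀.b₆, by rw [hV₀]; simp [baseChange]⟩
  have h₈ : ‖(V.b₈ : ℚ_[2])‖ ≤ 1 := hb _ ⟨V₀.b₈, by rw [hV₀]; simp [baseChange]⟩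
  set u := ‖(x' : ℚ_[2])‖ with hu
  have hx1 : 1 < u := lt_trans (by norm_num) hx
  have hu0 : 0 < u := one_pos.trans hx1
  have h2le : ‖(2 : ℚ_[2])‖ ≤ 1 := by exact_mod_cast Padic.norm_int_le_one (p := 2) 2
  have h4 : ‖(4 : ℚ_[2])‖ = 4⁻¹ := by
    rw [show (4 : ℚ_[2]) = ((2 : ℕ) : ℚ_[2]) ^ 2 by norm_num, norm_pow, Padic.norm_p]; norm_num
  have htailA : ‖((V.b₄ : ℚ_[2]) * (x' : ℚ_[2]) ^ 2 + 2 * V.b₆ * x' + V.b₈)‖ ≤ u ^ 2 := by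
    refine (Padic.nonarchimedean _ _).trans (max_le ((Padic.nonarchimedean _ _).trans (max_le ?_ ?_)) ?_)
    · rw [norm_mul, norm_pow]; exact mul_le_of_le_one_left (pow_nonneg hu0.le 2) h₄
    · rw [norm_mul, norm_mul]
      calc ‖(2 : ℚ_[2])‖ * ‖(V.b₆ : ℚ_[2])‖ * u ≤ 1 * 1 * u := by gcongr
        _ ≤ u ^ 2 := by rw [one_mul, one_mul, sq]; exact le_mul_of_one_le_left hu0.le hx1.le
    · exact h₈.trans (one_le_pow₀ hx1.le)
  have htailB : ‖((V.b₂ : ℚ_[2]) * (x' : ℚ_[2]) ^ 2 + 2 * V.b₄ * x' + V.b₆)‖ ≤ u ^ 2 := by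
    refine (Padic.nonarchimedean _ _).trans (max_le ((Padic.nonarchimedean _ _).trans (max_le ?_ ?_)) ?_)
    · rw [norm_mul, norm_pow]; exact mul_le_of_le_one_left (pow_nonneg hu0.le 2) h₂
    · rw [norm_mul, norm_mul]
      calc ‖(2 : ℚ_[2])‖ * ‖(V.b₄ : ℚ_[2])‖ * u ≤ 1 * 1 * u := by gcongr
        _ ≤ u ^ 2 := by rw [one_mul, one_mul, sq]; exact le_mul_of_one_le_left hu0.le hx1.le
    · exact h₆.trans (one_le_pow₀ hx1.le)
  constructor
  · have hlead : ‖(x' : ℚ_[2]) ^ 4‖ = u ^ 4 := by rw [norm_pow]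
    have hlt : u ^ 2 < u ^ 4 := pow_lt_pow_right₀ hx1 (by norm_num)
    have hne : ‖(x' : ℚ_[2]) ^ 4‖ ≠ ‖-((V.b₄ : ℚ_[2]) * (x' : ℚ_[2]) ^ 2 + 2 * V.b₆ * x' + V.b₈)‖ := by
      rw [hlead, norm_neg]; exact ne_of_gt (htailA.trans_lt hlt)
    have := Padic.add_eq_max_of_ne hne
    rw [hlead, norm_neg, max_eq_left (htailA.trans hlt.le)] at this
    push_cast
    rw [show ((x' : ℚ_[2]) ^ 4 - V.b₄ * x' ^ 2 - 2 * V.b₆ * x' - V.b₈) =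
      (x' : ℚ_[2]) ^ 4 + -((V.b₄ : ℚ_[2]) * (x' : ℚ_[2]) ^ 2 + 2 * V.b₆ * x' + V.b₈) by ring]
    exact this
  · have hlead : ‖(4 : ℚ_[2]) * (x' : ℚ_[2]) ^ 3‖ = 4⁻¹ * u ^ 3 := by rw [norm_mul, norm_pow, h4]
    have hlt : u ^ 2 < 4⁻¹ * u ^ 3 := by
      rw [show 4⁻¹ * u ^ 3 = u ^ 2 * (u / 4) by ring]
      exact lt_mul_of_one_lt_right (pow_pos hu0 2) (by rw [one_lt_div (by norm_num)]; exact hx)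
    have hne : ‖(4 : ℚ_[2]) * (x' : ℚ_[2]) ^ 3‖ ≠ ‖((V.b₂ : ℚ_[2]) * (x' : ℚ_[2]) ^ 2 + 2 * V.b₄ * x' + V.b₆)‖ := by
      rw [hlead]; exact ne_of_gt (htailB.trans_lt hlt)
    have := Padic.add_eq_max_of_ne hne
    rw [hlead, max_eq_left (htailB.trans hlt.le)] at this
    push_cast
    rw [show ((4 : ℚ_[2]) * (x' : ℚ_[2]) ^ 3 + V.b₂ * x' ^ 2 + 2 * V.b₄ * x' + V.b₆) =
      (4 : ℚ_[2]) * (x' : ℚ_[2]) ^ 3 + ((V.b₂ : ℚ_[2]) * (x' : ℚ_[2]) ^ 2 + 2 * V.b₄ * x' + V.b₆) by ring]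
    exact this

end TwoAdic

/-! ### §3 The boundary: `IsCanonicalSqMinusTwist` from the pinning off the boundary -/

section Boundary

variable (V : WeierstrassCurve ℚ) [V.IsElliptic] [V.IsIntegral ℤ] (d : ℤ)

/-- **A datum equal to the receptacle formula OFF the boundary is equal to it everywhere.** If
`D : PAdicHeightData (V.quadraticTwist d) 2` satisfies `⟨P,P⟩_D = canonicalPAdicHeightSqMinusTwist V 2 d P`
for every admissible `P = (X, Y)` with `‖4X‖₂ > 1` (`exists_padicHeightData_eq_canonicalPAdicHeightSqMinusTwist`),
then `D.IsCanonicalSqMinusTwist`: for a boundary point `P` (`‖4X‖₂ ≤ 1`, i.e. `ord₂ x′ = −3`, `d = ±2`),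
`2P` is admissible off the boundary (`‖x′(2P)‖₂ = 4‖x′‖₂`; odd primes through the integral twist model's
non-singular-reduction subgroups), so `4⟨P,P⟩ = ⟨2P,2P⟩ = h(2P) = 4h(P)` by the `x`-only duplication law
`canonicalPAdicHeightSqMinusTwist_two_smul`. [Mazur–Stein–Tate 2006, §1 eq. (1.1) («extends uniquely …
h_p(nQ) = n²h_p(Q)»)] [cite: MazurSteinTate2006, §1] -/
theorem isCanonicalSqMinusTwist_of_eq_off_boundary (hd : d = -1 ∨ d = 2 ∨ d = -2)
    (hex : ∃ Sq : ℚ_[2]⟦X⟧, ∃ c : ℚ_[2], (V.baseChange ℚ_[2]).IsMazurTateSigmaSqPair Sq c)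
    {D : PAdicHeightData (V.quadraticTwist (d : ℚ)) 2}
    (hD : ∀ (X Y : ℚ) (h : (V.quadraticTwist (d : ℚ)).toAffine.Nonsingular X Y),
      V.IsAdmissibleMinusTwist 2 (d : ℚ) (.some X Y h) → 1 < ‖((4 * X : ℚ) : ℚ_[2])‖ →
        D.pairing (.some X Y h) (.some X Y h) = V.canonicalPAdicHeightSqMinusTwist 2 (d : ℚ) (.some X Y h)) :
    D.IsCanonicalSqMinusTwist := by
  intro P hP
  rcases P with _ | ⟨X, Y, h⟩
  · exact (V.not_isAdmissibleMinusTwist_zero 2 (d : ℚ) hP).elim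
  by_cases hX4 : 1 < ‖((4 * X : ℚ) : ℚ_[2])‖
  · exact hD X Y h hP hX4
  -- a boundary point
  have hd0 : d ≠ 0 := by rcases hd with rfl | rfl | rfl <;> norm_num
  have hd0' : (d : ℚ) ≠ 0 := by exact_mod_cast hd0
  obtain ⟨hfin, hloc⟩ := hP
  obtain ⟨hx1, hdisc, hmin, -⟩ : V.MinusTwistLocalConditions 2 (d : ℚ) (.some X Y h) := hloc
  have hrad : ((2 : ℕ) : ℝ) ^ (-(2 / (((2 : ℕ) : ℝ) - 1))) = 4⁻¹ := by
    rw [show (-(2 / (((2 : ℕ) : ℝ) - 1))) = ((-2 : ℤ) : ℝ) by norm_num, Real.rpow_intCast]; norm_num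
  rw [hrad, norm_inv] at hdisc
  set x' : ℚ := X / (d : ℚ) with hx'
  have hxpos : 0 < ‖(x' : ℚ_[2])‖ := one_pos.trans hx1
  have hx : 4 < ‖(x' : ℚ_[2])‖ := by
    have := (inv_lt_comm₀ hxpos (by norm_num)).mp hdisc
    rwa [inv_inv] at this
  have hmin' : ∀ ℓ : ℕ, ℓ.Prime → ℓ ≠ 2 → V.HasNonsingularMinusReductionAt (d : ℚ) ℓ x' :=
    fun ℓ hℓ hℓ2 => hmin ℓ hℓ hℓ2 hℓ2
  -- `2P ≠ O`
  set P : (V.quadraticTwist (d : ℚ)).toAffine.Point := .some X Y h with hPdef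
  have h2P0 : (2 : ℕ) • P ≠ 0 := fun h0 =>
    hfin ((isOfFinAddOrder_iff_nsmul_eq_zero).mpr ⟨2, two_pos, h0⟩)
  rcases h2 : (2 : ℕ) • P with _ | ⟨X₂, Y₂, h₂⟩
  · exact (h2P0 h2).elim
  -- the duplication law
  have hdup := V.canonicalPAdicHeightSqMinusTwist_two_smul d hd hex h hx hmin' h₂ h2
  -- `x′(2P) = Φ₂(x′)/ψ₂²(x′)` has size `4‖x′‖`
  obtain ⟨hB0, hx₂⟩ := V.minusTwistX_two_smul (d : ℚ) hd0' h h₂ h2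
  obtain ⟨hAn, hBn⟩ := V.norm_two_Φ₂_ΨSq₂ hx
  have hx₂n : ‖((X₂ / (d : ℚ) : ℚ) : ℚ_[2])‖ = 4 * ‖(x' : ℚ_[2])‖ := by
    rw [hx₂, Rat.cast_div, norm_div, hAn, hBn]
    field_simp
  -- `2P` is admissible, off the boundary
  have hadm₂ : V.IsAdmissibleMinusTwist 2 (d : ℚ) (.some X₂ Y₂ h₂) := by
    refine ⟨fun hfin₂ => hfin ?_, ?_⟩
    · rw [← h2] at hfin₂
      exact ((isOfFinAddOrder_nsmul).mp hfin₂).resolve_right two_ne_zero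
    show _ ∧ _ ∧ _ ∧ _
    refine ⟨by rw [hx₂n]; linarith, ?_, fun ℓ hℓ hℓ2 _ => ?_, fun h => (h rfl).elim⟩
    · rw [hrad, norm_inv, hx₂n]
      rw [inv_lt_comm₀ (by positivity) (by norm_num)]
      linarith
    · -- odd primes: through the integral twist model
      set C₂ : VariableChange ℚ := ⟨Units.mk0 (2 : ℚ) two_ne_zero, 0, 0, 0⟩ with hC₂
      set W := C₂⁻¹ • V.quadraticTwist (d : ℚ) with hWdef
      have hW : C₂ • W = V.quadraticTwist (d : ℚ) := smul_inv_smul C₂ _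
      haveI : W.IsElliptic := V.isElliptic_of_scaleTwo_smul_eq d W hd0 hW
      haveI : W.IsIntegral ℤ := V.isIntegral_of_scaleTwo_smul_eq d W hW
      haveI : Fact ℓ.Prime := ⟨hℓ⟩
      set ψ := VariableChange.pointEquiv (V.quadraticTwist (d : ℚ)) C₂⁻¹ with hψ
      have htoX : ∀ Z : ℚ, (C₂⁻¹).toX Z = 4 * Z := fun Z => by
        rw [VariableChange.toX_def, hC₂, VariableChange.inv_def]; simp; norm_num
      -- `ψ P` has non-singular reduction at `ℓ`, hence so has `ψ (2P) = 2 ψ P`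
      have hP₁ : ψ P ∈ W.nonsingularReductionSubgroupAt ℓ := by
        rw [hPdef, hψ, VariableChange.pointEquiv_some, mem_nonsingularReductionSubgroupAt_iff]
        have := V.hasNonsingularReductionAt_twistModel_of_minusTwist_odd d W hd hW
          ((VariableChange.nonsingular_iff (V.quadraticTwist (d : ℚ)) C₂⁻¹ X Y).mpr h)
          (fun ℓ' hℓ' hℓ'2 => by
            rw [htoX, show (4 * X / 4 / (d : ℚ)) = X / d by field_simp]
            exact hmin' ℓ' hℓ' hℓ'2) ℓ hℓ hℓ2
        exact this
      have hP₂ := AddSubgroup.nsmul_mem _ hP₁ 2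
      rw [← map_nsmul, h2, hψ, VariableChange.pointEquiv_some, mem_nonsingularReductionSubgroupAt_iff] at hP₂
      have hns₂ : W.HasNonsingularReductionAt ℓ ((C₂⁻¹).toX X₂) ((C₂⁻¹).toY X₂ Y₂) := hP₂
      have := V.hasNonsingularMinusReductionAt_of_twistModel d W hd hW
        ((VariableChange.nonsingular_iff (V.quadraticTwist (d : ℚ)) C₂⁻¹ X₂ Y₂).mpr h₂) hℓ hℓ2 hns₂
      rwa [htoX, show (4 * X₂ / 4 / (d : ℚ)) = X₂ / d by field_simp] at this
  have hX₂4 : 1 < ‖((4 * X₂ : ℚ) : ℚ_[2])‖ := by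
    have h4n : ‖(4 : ℚ_[2])‖ = 4⁻¹ := by
      rw [show (4 : ℚ_[2]) = ((2 : ℕ) : ℚ_[2]) ^ 2 by norm_num, norm_pow, Padic.norm_p]; norm_num
    have : ((4 * X₂ : ℚ) : ℚ_[2]) = 4 * (d : ℚ_[2]) * ((X₂ / (d : ℚ) : ℚ) : ℚ_[2]) := by
      push_cast; field_simp
    rw [this, norm_mul, norm_mul, h4n, hx₂n]
    have hdn : 2⁻¹ ≤ ‖(d : ℚ_[2])‖ := by
      rcases hd with rfl | rfl | rfl
      · norm_num
      · push_cast; rw [show (2 : ℚ_[2]) = ((2 : ℕ) : ℚ_[2]) by norm_num, Padic.norm_p]; norm_num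
      · push_cast; rw [norm_neg, show (2 : ℚ_[2]) = ((2 : ℕ) : ℚ_[2]) by norm_num, Padic.norm_p]; norm_num
    nlinarith
  -- assemble: `4⟨P,P⟩ = ⟨2P,2P⟩ = h(2P) = 4h(P)`
  have hD₂ := hD X₂ Y₂ h₂ hadm₂ hX₂4
  have hbil : D.pairing (.some X₂ Y₂ h₂) (.some X₂ Y₂ h₂) = 4 * D.pairing P P := by
    rw [← h2]
    have e1 : D.pairing (2 • P) = 2 • D.pairing P := map_nsmul D.pairing 2 P
    calc D.pairing (2 • P) (2 • P) = (2 • D.pairing P) (2 • P) := by rw [e1]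
      _ = 2 • (D.pairing P (2 • P)) := AddMonoidHom.nsmul_apply _ _ _
      _ = 2 • (2 • D.pairing P P) := by rw [map_nsmul]
      _ = 4 * D.pairing P P := by rw [smul_smul, nsmul_eq_mul]; norm_num
  rw [hbil, hdup] at hD₂
  have h4 : (4 : ℚ_[2]) ≠ 0 := by norm_num
  exact mul_left_cancel₀ h4 hD₂

/-- **THE canonical `2`-adic height datum on the minus part of `V^{(d)}` EXISTS, `d ∈ {−1, 2, −2}`**:
for `V/ℚ` elliptic `ℤ`-integral with a sigma-squared pair at `2` there is `D : PAdicHeightData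
(V.quadraticTwist d) 2` with `D.IsCanonicalSqMinusTwist` — the receptacle of `PadicSigmaSqMinusTwist.lean`
is inhabited for all three classes (the pinning `exists_padicHeightData_eq_canonicalPAdicHeightSqMinusTwist`
off the boundary + `isCanonicalSqMinusTwist_of_eq_off_boundary`). [Mazur–Stein–Tate 2006, §1 eq. (1.1),
§2.7; Silverman 2005, §5 Rem. 2] [cite: MazurSteinTate2006, §2.7] [cite: Silverman2005DivPoly, §5 Rem. 2] -/
theorem exists_isCanonicalSqMinusTwist (hd : d = -1 ∨ d = 2 ∨ d = -2)
    (hex : ∃ Sq : ℚ_[2]⟦X⟧, ∃ c : ℚ_[2], (V.baseChange ℚ_[2]).IsMazurTateSigmaSqPair Sq c) :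
    ∃ D : PAdicHeightData (V.quadraticTwist (d : ℚ)) 2, D.IsCanonicalSqMinusTwist := by
  obtain ⟨D, hD⟩ := V.exists_padicHeightData_eq_canonicalPAdicHeightSqMinusTwist d hd hex
  exact ⟨D, V.isCanonicalSqMinusTwist_of_eq_off_boundary d hd hex hD⟩

/-- **… and it is UNIQUE**: `∃! D, D.IsCanonicalSqMinusTwist` (`d ∈ {−1, 2, −2}`).
[Mazur–Stein–Tate 2006, §1 («extends uniquely»), §2.7] [cite: MazurSteinTate2006, §2.7] -/
theorem existsUnique_isCanonicalSqMinusTwist (hd : d = -1 ∨ d = 2 ∨ d = -2)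
    (hex : ∃ Sq : ℚ_[2]⟦X⟧, ∃ c : ℚ_[2], (V.baseChange ℚ_[2]).IsMazurTateSigmaSqPair Sq c) :
    ∃! D : PAdicHeightData (V.quadraticTwist (d : ℚ)) 2, D.IsCanonicalSqMinusTwist := by
  obtain ⟨D, hD⟩ := V.exists_isCanonicalSqMinusTwist d hd hex
  exact ⟨D, hD, fun D' hD' => PAdicHeightData.isCanonicalSqMinusTwist_unique hd hD' hD⟩

end Boundary

/-! ### §4 `49a1^{(4k+1)}` and its twists by `−1, ±2`: binder-free -/

section Cm7

variable (W : WeierstrassCurve ℚ) (k : ℤ)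

/-- **THE canonical `2`-adic height datum on the minus part of `W_k^{(d)}`, `W_k = 49a1^{(4k+1)}`
(`y² + xy = x³ − (3k+1)x² − 2(4k+1)²x − (4k+1)³`), `d ∈ {−1, 2, −2}`, EXISTS UNIQUELY — no binder**: the
sigma-squared pair of `W_k ⊗ ℚ₂` is the square of the CM sigma function
(`cm7Twist_exists_isMazurTateSigmaSqPair_two`). This instantiates, uniquely, the
`∀ D, IsCanonicalSqMinusTwist D → …` binder of Bertrand's non-vanishing on the minus part
(`bertrand_pairingSqMinusTwist_self_ne_zero_two`) for all three classes `d ∈ {−1, 2, −2}` of road (C).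
[Perrin-Riou 1984, Ch. III §1.2 Lemme 2; Mazur–Stein–Tate 2006, §2.7; Bertrand 1984, §3 Cor. 1]
[cite: Perrinriou1984, Ch. III §1.2 Lemme 2] [cite: MazurSteinTate2006, §2.7] -/
theorem cm7Twist_existsUnique_isCanonicalSqMinusTwist
    (hW : W = ⟨1, -(3 * (k : ℚ) + 1), 0, -2 * (4 * (k : ℚ) + 1) ^ 2, -(4 * (k : ℚ) + 1) ^ 3⟩)
    {d : ℤ} (hd : d = -1 ∨ d = 2 ∨ d = -2) :
    ∃! D : PAdicHeightData (W.quadraticTwist (d : ℚ)) 2, D.IsCanonicalSqMinusTwist := by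
  haveI : W.IsElliptic := cm7Twist_isElliptic W k hW
  haveI : W.IsIntegral ℤ := by
    subst hW
    exact isIntegral_of_exists_lift ℤ ⟨1, by simp⟩ ⟨-(3 * k + 1), by rw [eq_intCast]; push_cast; ring⟩
      ⟨0, by simp⟩ ⟨-2 * (4 * k + 1) ^ 2, by rw [eq_intCast]; push_cast; ring⟩
      ⟨-(4 * k + 1) ^ 3, by rw [eq_intCast]; push_cast; ring⟩
  exact W.existsUnique_isCanonicalSqMinusTwist d hd (cm7Twist_exists_isMazurTateSigmaSqPair_two W k hW)

end Cm7

end WeierstrassCurve
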